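import Literature.AlgebraicGeometry.Frobenioids.UnitTrivializationPerfectionModel
import Literature.AlgebraicGeometry.Frobenioids.PerfectionModelElemCompat
import Literature.AlgebraicGeometry.Frobenioids.PerfectionUntrCommuteElem
import HarnessLib

/-!
# Frobenioids I, Prop. 5.3: `(C^un-tr)^pf` IS the model Frobenioid of `(Φ^pf, (Φ^birat)^pf)` — the comparison
# equivalence is compatible with the functors to the elementary Frobenioid `F_{Φ^pf}` (proof-only sequel)

Mochizuki, *The geometry of Frobenioids I: the general theory*, Kyushu J. Math. **62** (2008) 293–400,
§5, Prop. 5.3 p. 103 ll. 16–19 [cite: MochizukiFrdI2008, Prop. 5.3 p.103]: "Moreover, the Frobenioid `C^un-tr`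
(respectively, `(C^un-tr)^pf`) is of model type and may be obtained as the model Frobenioid associated to the
divisor monoid `Φ` (respectively, `Φ^pf`) and the rational function monoid `Φ^birat` (respectively,
`ℚ · Φ^birat = Φ^birat ⊗_ℤ ℚ = (Φ^birat)^pf`)"; proof p. 103 ll. 34–36 ("follow immediately from the definitions
and Theorem 5.2, (ii), (iv)").

A Frobenioid is a category TOGETHER WITH its functor to an elementary Frobenioid `F_Φ` (Def. 1.1 (iv), Def. 1.3);
"may be obtained as the model Frobenioid" is therefore read as an equivalence compatible with the structure
functors to `F_{Φ^pf}` (the reading print makes explicit in the parallel clause Prop. 5.5 (iv) p. 104 l. 41,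
"[compatible with the functors to the respective elementary Frobenioids]").  The landed row P53/L04 of the
abc-iut sub-DAG `plan/L1/SUBDAG-FrdI-Prop53-Cor54.md` (`PreFrobenioid.exists_untrPf_comparison_overBase`,
`UnitTrivializationPerfectionModel.lean`, seat abc-iut-L1-d5 gen 4) records the equivalence
`(C^un-tr)^pf ≌ (model Frobenioid of (Φ^pf, (Φ^birat)^pf, Div^pf))` over the BASE CATEGORY `D` only.  This
proof-only sequel (seat abc-iut-L1-d5 gen 5) removes that weakening for the SAME equivalence:

* §1 (generic, Thm. 3.4 (iii) / Prop. 3.2 (i) bookkeeping): if `G : C₁ → C₂` is Frobenius-compatible and lies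
  over `F_Φ` up to an isomorphism of structure functors `i : G ⋙ F₂ ≅ F₁`, then its perfection
  `G^pf : C₁^pf → C₂^pf` (`Perfection.map`, seats abc-iut-L1-d9/d1) lies over `F_{Φ^pf}`:
  `G^pf ⋙ (C₂^pf → F_{Φ^pf}) ≅ (C₁^pf → F_{Φ^pf})`, with components `(b_A, 0, 1)` where `b_A = Base(i_A)`
  (`Perfection.nonempty_map_comp_toFunctor_iso`; `Base` from `Perfection.baseMap_repMap_comp`, `Div` from
  `Perfection.div_repMap` and the dictionary `StructureIso.*` of seat abc-iut-L6-t9, `deg_Fr` from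
  `Perfection.degFr_map_map`);
* §2 the comparison `C^pf → model` of Prop. 5.5 (iv) followed by the model's structure functor IS the structure
  functor of `C^pf` (`Perfection.ModelPf.toModelPf_comp_toElem`, definitional — the content of
  `PerfectionModelElemCompat.lean`, seat abc-iut-w5-d049, in functor form);
* §3 **`PreFrobenioid.exists_untrPf_comparison_elem`**: for a Frobenioid `C → F_Φ` there is an equivalence
  `(C^un-tr)^pf ≌ (model Frobenioid of (Φ^pf, (Φ^birat)^pf, Div^pf))` whose functor, followed by the model's
  structure functor to `F_{Φ^pf}`, is isomorphic to the structure functor `(C^un-tr)^pf → F_{Φ^pf}`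
  (Prop. 3.2 (i)); the base-level clause of row P53/L04 is recovered by whiskering with `F_{Φ^pf} → D`
  (`exists_untrPf_comparison_elem_overBase`).  Binders as in row P53/L04 (Thm. 5.2's standing hypotheses for
  `(Φ, Φ^birat)`, `ModelFrobenioid.Hypotheses`, and perfected divisor data, `IsPerfectedDiv`).

No definitions, no new named facts; nothing is weakened or strengthened relative to print beyond what the
docstrings say.  Honest framing: kernel bookkeeping for a refereed 2008 statement ([FrdI]); nothing here
bears on [IUTchIII] Cor. 3.12; typed ≠ proved elsewhere in the cell is unaffected.
-/

namespace Literature.AlgebraicGeometry.Frobenioids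

open CategoryTheory Opposite

/-! ### §0 Naturality squares against the isomorphisms `(b, 0, 1)` of `F_Φ` -/

namespace ElemFrobenioid

universe w₀ v₀ u₀

variable {D : Type u₀} [Category.{v₀} D] {Φ : Dᵒᵖ ⥤ CommMonCat.{w₀}}

/-- A square `φ ≫ (g, 0, 1) = (f, 0, 1) ≫ φ'` in `F_Φ` against the isomorphisms `isoMk` over isomorphisms
`f`, `g` of `D` commutes as soon as `Base(φ) ≫ g = f ≫ Base(φ')`, `Div(φ) = f^* Div(φ')` and
`deg_Fr(φ) = deg_Fr(φ')` (the composition law of Def. 1.1 (iii) with `Div = 0`, `deg_Fr = 1` on the isomorphisms).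
[cite: MochizukiFrdI2008, Def. 1.1 (iii) p.20] -/
theorem comp_isoMk_hom_eq {A A' B' B : ElemFrobenioid Φ} (φ : A ⟶ B') (φ' : A' ⟶ B)
    (f : A.base ≅ A'.base) (g : B'.base ≅ B.base)
    (hb : Base φ ≫ g.hom = f.hom ≫ Base φ') (hd : Div φ = pull Φ f.hom (Div φ'))
    (hn : degFr φ = degFr φ') :
    φ ≫ (isoMk Φ g).hom = (isoMk Φ f).hom ≫ φ' := by
  refine Hom.ext hb ?_ ?_
  · change pull Φ (Base φ) 1 * Div φ ^ ((1 : ℕ+) : ℕ) = pull Φ f.hom (Div φ') * 1 ^ (degFr φ' : ℕ)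
    rw [map_one, one_mul, PNat.one_coe, pow_one, one_pow, mul_one]
    exact hd
  · change degFr φ * 1 = 1 * degFr φ'
    rw [mul_one, one_mul]
    exact hn

end ElemFrobenioid

namespace PreFrobenioid

/-! ### §1 `G^pf` lies over `F_{Φ^pf}` when `G` lies over `F_Φ` -/

namespace Perfection

section MapElem

universe w v u v₁' u₁' v₂' u₂'

variable {D : Type u} [Category.{v} D] {Φ : Dᵒᵖ ⥤ CommMonCat.{w}}
  {C₁ : Type u₁'} [Category.{v₁'} C₁] {F₁ : C₁ ⥤ ElemFrobenioid Φ} {hF₁ : IsFrobenioid F₁}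
  {C₂ : Type u₂'} [Category.{v₂'} C₂] {F₂ : C₂ ⥤ ElemFrobenioid Φ} {hF₂ : IsFrobenioid F₂}
  {G : C₁ ⥤ C₂} (hG : IsFrobeniusCompatible F₁ F₂ G)

/-- `G` lies over `D` up to the base components `b_A = Base(i_A)` of `i`: `Base(G φ) ≫ b_B = b_A ≫ Base(φ)`.
[cite: MochizukiFrdI2008, Def. 1.1 (iv) p.20] -/
theorem base_map_comp_base_app (i : G ⋙ F₂ ≅ F₁) {A B : C₁} (φ : A ⟶ B) :
    Base F₂ (G.map φ) ≫ ElemFrobenioid.Base (i.hom.app B) = ElemFrobenioid.Base (i.hom.app A) ≫ Base F₁ φ := by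
  rw [StructureIso.base_eq i φ, StructureIso.base_hom_inv_app_assoc]
  rfl

/-- **`Base` of `G^pf[r]` vs `Base` of `[r]` through the base components of `i`**:
`Base(G^pf[r]) ≫ b_B = b_A ≫ Base([r])` (the comparison isomorphisms `G(A^{(a)}) ≅ (G A)^{(a)}` lie under `G A`,
`baseMap_repMap_comp`). [cite: MochizukiFrdI2008, Prop. 3.2 (i) p.58] -/
theorem baseMap_repMap_comp_base_app (i : G ⋙ F₂ ≅ F₁) {X Y : Perfection hF₁} (r : Rep X Y) :
    (repMap (hF₁ := hF₁) (hF₂ := hF₂) hG r).baseMap ≫ ElemFrobenioid.Base (i.hom.app Y.obj) =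
      ElemFrobenioid.Base (i.hom.app X.obj) ≫ r.baseMap := by
  haveI : IsIso (Base F₁ (frob hF₁ Y.obj r.L.b)) := isIso_base_frob hF₁ Y.obj r.L.b
  have e₁ := baseMap_repMap_comp (hF₁ := hF₁) (hF₂ := hF₂) hG r
  have nY := base_map_comp_base_app i (frob hF₁ Y.obj r.L.b)
  have nX := base_map_comp_base_app i (frob hF₁ X.obj r.L.a)
  have nr := base_map_comp_base_app i r.hom
  have e₂ : r.baseMap ≫ Base F₁ (frob hF₁ Y.obj r.L.b) =
      Base F₁ (frob hF₁ X.obj r.L.a) ≫ Base F₁ r.hom := by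
    unfold Rep.baseMap
    simp only [Category.assoc, baseInvFrob_base_frob, Category.comp_id]
  refine (cancel_mono (Base F₁ (frob hF₁ Y.obj r.L.b))).mp ?_
  calc ((repMap (hF₁ := hF₁) (hF₂ := hF₂) hG r).baseMap ≫ ElemFrobenioid.Base (i.hom.app Y.obj)) ≫
          Base F₁ (frob hF₁ Y.obj r.L.b)
      = (repMap (hF₁ := hF₁) (hF₂ := hF₂) hG r).baseMap ≫
          (ElemFrobenioid.Base (i.hom.app Y.obj) ≫ Base F₁ (frob hF₁ Y.obj r.L.b)) :=
        Category.assoc _ _ _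
    _ = (repMap (hF₁ := hF₁) (hF₂ := hF₂) hG r).baseMap ≫
          (Base F₂ (G.map (frob hF₁ Y.obj r.L.b)) ≫
            ElemFrobenioid.Base (i.hom.app (frobPow hF₁ Y.obj r.L.b))) :=
        (congrArg ((repMap (hF₁ := hF₁) (hF₂ := hF₂) hG r).baseMap ≫ ·) nY).symm
    _ = ((repMap (hF₁ := hF₁) (hF₂ := hF₂) hG r).baseMap ≫ Base F₂ (G.map (frob hF₁ Y.obj r.L.b))) ≫
            ElemFrobenioid.Base (i.hom.app (frobPow hF₁ Y.obj r.L.b)) :=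
        (Category.assoc _ _ _).symm
    _ = (Base F₂ (G.map (frob hF₁ X.obj r.L.a)) ≫ Base F₂ (G.map r.hom)) ≫
            ElemFrobenioid.Base (i.hom.app (frobPow hF₁ Y.obj r.L.b)) :=
        congrArg (· ≫ ElemFrobenioid.Base (i.hom.app (frobPow hF₁ Y.obj r.L.b))) e₁
    _ = Base F₂ (G.map (frob hF₁ X.obj r.L.a)) ≫ (Base F₂ (G.map r.hom) ≫
            ElemFrobenioid.Base (i.hom.app (frobPow hF₁ Y.obj r.L.b))) :=
        Category.assoc _ _ _
    _ = Base F₂ (G.map (frob hF₁ X.obj r.L.a)) ≫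
          (ElemFrobenioid.Base (i.hom.app (frobPow hF₁ X.obj r.L.a)) ≫ Base F₁ r.hom) :=
        congrArg (Base F₂ (G.map (frob hF₁ X.obj r.L.a)) ≫ ·) nr
    _ = (Base F₂ (G.map (frob hF₁ X.obj r.L.a)) ≫
          ElemFrobenioid.Base (i.hom.app (frobPow hF₁ X.obj r.L.a))) ≫ Base F₁ r.hom :=
        (Category.assoc _ _ _).symm
    _ = (ElemFrobenioid.Base (i.hom.app X.obj) ≫ Base F₁ (frob hF₁ X.obj r.L.a)) ≫ Base F₁ r.hom :=
        congrArg (· ≫ Base F₁ r.hom) nX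
    _ = ElemFrobenioid.Base (i.hom.app X.obj) ≫ (Base F₁ (frob hF₁ X.obj r.L.a) ≫ Base F₁ r.hom) :=
        Category.assoc _ _ _
    _ = ElemFrobenioid.Base (i.hom.app X.obj) ≫ (r.baseMap ≫ Base F₁ (frob hF₁ Y.obj r.L.b)) :=
        (congrArg (ElemFrobenioid.Base (i.hom.app X.obj) ≫ ·) e₂).symm
    _ = (ElemFrobenioid.Base (i.hom.app X.obj) ≫ r.baseMap) ≫ Base F₁ (frob hF₁ Y.obj r.L.b) :=
        (Category.assoc _ _ _).symm

/-- **The perfected divisor of `G^pf[r]` is `b_A^*` of the perfected divisor of `[r]`** (`Div(G θ) = b^* Div(θ)`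
for the representative, `StructureIso.pull_div_eq`, and `div_repMap`). [cite: MochizukiFrdI2008, Prop. 3.2 (i) p.58] -/
theorem div_repMap_eq_map_pull (i : G ⋙ F₂ ≅ F₁) {X Y : Perfection hF₁} (r : Rep X Y) :
    (repMap (hF₁ := hF₁) (hF₂ := hF₂) hG r).div =
      Frobenioids.Perfection.map (pull Φ (ElemFrobenioid.Base (i.hom.app X.obj))) r.div := by
  have hΦ : ∀ A : D, IsSharp (Φ.obj (op A)) := fun A => (hF₁.isPreFrobenioid.isDivisorial A).isSharp
  have hd : pull Φ (ElemFrobenioid.Base (i.hom.app (frobPow hF₁ X.obj r.L.a))) (Div F₁ r.hom) =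
      Div F₂ (G.map r.hom) :=
    StructureIso.pull_div_eq i hΦ r.hom
  have key : pull Φ (Base F₂ (G.map (frob hF₁ X.obj r.L.a))) (Div F₂ (G.map r.hom)) =
      pull Φ (ElemFrobenioid.Base (i.hom.app X.obj)) (pull Φ (Base F₁ (frob hF₁ X.obj r.L.a)) (Div F₁ r.hom)) :=
    calc pull Φ (Base F₂ (G.map (frob hF₁ X.obj r.L.a))) (Div F₂ (G.map r.hom))
        = pull Φ (Base F₂ (G.map (frob hF₁ X.obj r.L.a)))
            (pull Φ (ElemFrobenioid.Base (i.hom.app (frobPow hF₁ X.obj r.L.a))) (Div F₁ r.hom)) :=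
          congrArg (pull Φ (Base F₂ (G.map (frob hF₁ X.obj r.L.a)))) hd.symm
      _ = pull Φ (Base F₂ (G.map (frob hF₁ X.obj r.L.a)) ≫
            ElemFrobenioid.Base (i.hom.app (frobPow hF₁ X.obj r.L.a))) (Div F₁ r.hom) :=
          (pull_comp Φ _ _ _).symm
      _ = pull Φ (ElemFrobenioid.Base (i.hom.app X.obj) ≫ Base F₁ (frob hF₁ X.obj r.L.a)) (Div F₁ r.hom) :=
          congrArg (fun β => pull Φ β (Div F₁ r.hom)) (base_map_comp_base_app i (frob hF₁ X.obj r.L.a))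
      _ = pull Φ (ElemFrobenioid.Base (i.hom.app X.obj))
            (pull Φ (Base F₁ (frob hF₁ X.obj r.L.a)) (Div F₁ r.hom)) :=
          pull_comp Φ _ _ _
  rw [div_repMap (hF₁ := hF₁) (hF₂ := hF₂) hG r, key]
  rfl

/-- **`deg_Fr(G^pf[r]) = deg_Fr([r])`** (`G` preserves all Frobenius degrees, `StructureIso.degFr_eq`, hence so does
`G^pf`, `degFr_map_map`). [cite: MochizukiFrdI2008, Prop. 3.2 (i) p.58] -/
theorem degFr_repMap_eq (i : G ⋙ F₂ ≅ F₁) {X Y : Perfection hF₁} (r : Rep X Y) :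
    (repMap (hF₁ := hF₁) (hF₂ := hF₂) hG r).degFr = r.degFr :=
  degFr_map_map (hF₁ := hF₁) (hF₂ := hF₂) hG
    (fun _ _ f => show degFr (G ⋙ F₂) f = degFr F₁ f from (StructureIso.degFr_eq i f).symm) (Hom.mk r)

/-- **`G^pf` lies over `F_{Φ^pf}`**: for `G : C₁ → C₂` Frobenius-compatible and lying over `F_Φ` up to `i : G ⋙ F₂ ≅ F₁`,
the perfection `G^pf : C₁^pf → C₂^pf` followed by the structure functor `C₂^pf → F_{Φ^pf}` (Prop. 3.2 (i)) is
isomorphic to `C₁^pf → F_{Φ^pf}`, with components `(b_A, 0, 1)`, `b_A = Base(i_A)` — the `1`-commutativity of the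
square of Thm. 3.4 (iii) read at the level of the elementary Frobenioid. [cite: MochizukiFrdI2008, Thm. 3.4 (iii) p.62] -/
theorem nonempty_map_comp_toFunctor_iso (i : G ⋙ F₂ ≅ F₁) :
    Nonempty (map (hF₁ := hF₁) (hF₂ := hF₂) hG ⋙ (ops hF₂).toFunctor ≅ (ops hF₁).toFunctor) := by
  refine ⟨NatIso.ofComponents (fun X => ElemFrobenioid.isoMk (ops hF₂).monFunctor
    (show baseObj F₂ (G.obj X.obj) ≅ baseObj F₁ X.obj from
      ⟨ElemFrobenioid.Base (i.hom.app X.obj), ElemFrobenioid.Base (i.inv.app X.obj),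
        StructureIso.base_hom_inv_app i X.obj, StructureIso.base_inv_hom_app i X.obj⟩)) ?_⟩
  intro X Y f
  obtain ⟨r, rfl⟩ := Hom.mk_surjective f
  exact ElemFrobenioid.comp_isoMk_hom_eq _ _ _ _ (baseMap_repMap_comp_base_app hG i r)
    (div_repMap_eq_map_pull hG i r) (degFr_repMap_eq hG i r)

end MapElem

/-! ### §2 The comparison `C^pf → model` of Prop. 5.5 (iv) lies over `F_{Φ^pf}` on the nose, in functor form -/

namespace ModelPf

universe w v u

variable {D : Type u} [Category.{v} D] {Φ B : Dᵒᵖ ⥤ CommMonCat.{w}} {DivB : B ⟶ monoidGp Φ}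
  {hF : IsFrobenioid (ModelFrobenioid.toElem Φ B DivB)}
  (DivBpf : perfectionFunctor B ⟶ monoidGp (perfectionFunctor Φ))
  (hB : Objectwise (fun M _ => IsGroupLike M) B) (hDiv : IsPerfectedDiv Φ B DivB DivBpf)

/-- **Prop. 5.5 (iv) for `C^pf`, functor form of "[compatible with the functors to the respective elementary
Frobenioids]"**: `toModelPf ⋙ (model → F_{Φ^pf})` IS the structure functor `C^pf → F_{Φ^pf}` of Prop. 3.2 (i)
(definitionally; `PerfectionModelElemCompat.ofFunctor_toModelPf_comp_toElem` is the operations form).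
[cite: MochizukiFrdI2008, Prop. 5.5 (iv) p.104] -/
theorem toModelPf_comp_toElem :
    toModelPf hF DivBpf hB hDiv ⋙ ModelFrobenioid.toElem _ _ _ = (ops hF).toFunctor :=
  rfl

end ModelPf

end Perfection

/-! ### §3 Row P53/L04 at the level of `F_{Φ^pf}` -/

universe w v v' u u'

variable {D : Type u} [Category.{v} D] {Φ : Dᵒᵖ ⥤ CommMonCat.{w}}
  {C : Type u'} [Category.{v'} C] {F : C ⥤ ElemFrobenioid Φ}

/-- **[FrdI] Prop. 5.3, `(C^un-tr)^pf` clause, as an equivalence OF FROBENIOIDS**: for a Frobenioid `C → F_Φ`,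
THE perfection of THE unit-trivialisation `(C^un-tr)^pf` is equivalent to the model Frobenioid of the perfected
data `(Φ^pf, (Φ^birat)^pf, Div^pf)` by an equivalence whose functor, followed by the model's structure functor to
`F_{Φ^pf}` (Thm. 5.2 (i)), is isomorphic to the structure functor `(C^un-tr)^pf → F_{Φ^pf}` (Prop. 3.2 (i)) —
granted Thm. 5.2's standing hypotheses for `(Φ, Φ^birat)` (`h`) and perfected divisor data (`hDiv`), exactly the
binders of row P53/L04.  The equivalence is the one of `exists_untrPf_comparison_overBase`: `(untrComparison)^pf`
(§1 applied to `untrComparison_compToElem`) followed by `toModelPf` (§2). [cite: MochizukiFrdI2008, Prop. 5.3 p.103] -/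
theorem exists_untrPf_comparison_elem (hF : IsFrobenioid F)
    (h : ModelFrobenioid.Hypotheses Φ (biratSubfunctor F).toMonoid)
    (DivBpf : perfectionFunctor (biratSubfunctor F).toMonoid ⟶ monoidGp (perfectionFunctor Φ))
    (hDiv : IsPerfectedDiv Φ (biratSubfunctor F).toMonoid (biratSubfunctor F).incl DivBpf) :
    ∃ e : Perfection (isFrobenioid_untr hF) ≌
        ModelFrobenioid (perfectionFunctor Φ) (perfectionFunctor (biratSubfunctor F).toMonoid) DivBpf,
      Nonempty (e.functor ⋙ ModelFrobenioid.toElem _ _ _ ≅ (Perfection.ops (isFrobenioid_untr hF)).toFunctor) := by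
  let hG : IsFrobenioid (ModelFrobenioid.toElem Φ (biratSubfunctor F).toMonoid (biratSubfunctor F).incl) :=
    h.isFrobenioid Φ (biratSubfunctor F).toMonoid (biratSubfunctor F).incl
  let hΨ := isFrobeniusCompatible_untrComparison hF h
  obtain ⟨i⟩ := untrComparison_compToElem hF
  haveI := Perfection.map_isEquivalence (hF₁ := isFrobenioid_untr hF) (hF₂ := hG) (untrComparison F hF) hΨ
  haveI := Perfection.ModelPf.toModelPf_isEquivalence (hF := hG) DivBpf h.isGroupLike_rat hDiv h.isDivisorial
  obtain ⟨j⟩ := Perfection.nonempty_map_comp_toFunctor_iso (hF₁ := isFrobenioid_untr hF) (hF₂ := hG) hΨ i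
  refine ⟨(Perfection.map (hF₁ := isFrobenioid_untr hF) (hF₂ := hG) hΨ).asEquivalence.trans
      (Perfection.ModelPf.toModelPf hG DivBpf h.isGroupLike_rat hDiv).asEquivalence, ⟨?_⟩⟩
  exact Functor.associator _ _ _ ≪≫
    Functor.isoWhiskerLeft _ (eqToIso (Perfection.ModelPf.toModelPf_comp_toElem DivBpf h.isGroupLike_rat hDiv)) ≪≫ j

/-- **Row P53/L04, both levels at once**: the same equivalence lies over `F_{Φ^pf}` (previous theorem) AND — by
whiskering with the projection `F_{Φ^pf} → D` — over the base category `D` (the clause of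
`exists_untrPf_comparison_overBase`). [cite: MochizukiFrdI2008, Prop. 5.3 p.103] -/
theorem exists_untrPf_comparison_elem_overBase (hF : IsFrobenioid F)
    (h : ModelFrobenioid.Hypotheses Φ (biratSubfunctor F).toMonoid)
    (DivBpf : perfectionFunctor (biratSubfunctor F).toMonoid ⟶ monoidGp (perfectionFunctor Φ))
    (hDiv : IsPerfectedDiv Φ (biratSubfunctor F).toMonoid (biratSubfunctor F).incl DivBpf) :
    ∃ e : Perfection (isFrobenioid_untr hF) ≌
        ModelFrobenioid (perfectionFunctor Φ) (perfectionFunctor (biratSubfunctor F).toMonoid) DivBpf,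
      Nonempty (e.functor ⋙ ModelFrobenioid.toElem _ _ _ ≅ (Perfection.ops (isFrobenioid_untr hF)).toFunctor) ∧
      Nonempty (e.functor ⋙ ModelFrobenioid.baseFunctor _ _ _ ≅ (Perfection.ops (isFrobenioid_untr hF)).base) := by
  obtain ⟨e, ⟨j⟩⟩ := exists_untrPf_comparison_elem hF h DivBpf hDiv
  refine ⟨e, ⟨j⟩, ⟨?_⟩⟩
  exact Functor.isoWhiskerLeft e.functor (eqToIso (modelFrobenioid_baseFunctor_eq DivBpf)) ≪≫
    (Functor.associator e.functor (ModelFrobenioid.toElem _ _ _) (ElemFrobenioid.baseFunctor _)).symm ≪≫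
    Functor.isoWhiskerRight j (ElemFrobenioid.baseFunctor _)

end PreFrobenioid

end Literature.AlgebraicGeometry.Frobenioids
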